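import Summits.QuantumFields.BalabanUV.Beta.D1BFx.SymMixedTableMass

/-!
# `BalabanUV.Beta.D1BFx.MixedTableMass` — road «BF-x» for binder row D1, junction (J1), the (rest) row's table letter AT THE COMB TABLES («COMB-MIXED-TABLE-MASS»,
# the comb twin of «SYMMIX-MASS» FILES 4–5): **THE n-LAW OF NODE 12b's MIXED-TABLE MASS — `mixAbs (toSite r) L ≤ 75000 · d · (ell d L)³` FOR EVERY ROOT OFFSET IN
# THE BOX AND `1 ≤ L`; AT THE CENTRED ROOT `mixAbs (ctr d n) n ≤ 75000 · d · ((2d+2)·n)³` (`≍ n³`; at the road's `d = 4`: `≤ 3·10⁸·n³`)**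

HONEST DEPENDENCY (cell records, verbatim): «continuum YM on T⁴ ⇐ BetaPertH ∧ nine spine estimates (0/9 proved); BetaPertH ⇐ (D1) ∧ (D4) ∧
CAP+tail; G-an2-4 gates asym, D1 and NE2/3/4.»  HONEST FRAMING (cell contract, verbatim): «discharging `BetaPertH` makes Bałaban's UV stability
UNCONDITIONAL — a real constructive-QFT result; it is NOT the continuum limit and NOT the Clay problem.»  THIS MODULE DISCHARGES NOTHING of the
wall: [folklore] bookkeeping BY NAME over lit node 12b's `mixAbs ∕ tTab ∕ aTab ∕ apTab ∕ MjetAt ∕ PhiMAt ∕ PhiGAt ∕ map_PhiGAt ∕ Gm ∕ Gmb ∕ bondSet ∕ lettersIn_loopCAt_top`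
(`AveragingMixedJetTables`), lit `AveragingHessianKernelsRooted.loopCAt_length_le_ell`, lit node 12 (`expT ∕ logT ∕ invT ∕ holG ∕ mapDual ∕ map_logT ∕ map_invT`),
lit `AveragingContoursRooted` (`loopCAt ∕ ell ∕ ctr ∕ ctrOff_mem_box`) and this lineage's «SYMMIX-MASS» FILES 1–5 (`TruncatedAlgebraNorms ∕ WeightedRowSumNorm ∕
WordRecordingAlgebra ∕ SymMixedJetRecording ∕ SymMixedTableMass`: the seminorm letters, the recording algebra, `lvW`, the chart letters `rhoRS_Gm(b)_sub_one_le`,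
`seg_sub_one_le`, `sum_three_le`, `sum_bondSet_cube_eq`); kernel lane: 0 def, 0 cite, 0 `def … : Prop`, 0 sorry, NO hypothesis displayed; ONE scoped `synthInstance.maxHeartbeats 40000` (§1, heartbeat margin).  A TABLE-MASS LETTER
for the (rest) row re-instantiated at the COMB scheme's mixed table — an2 g55's RULING R-D1-g55-1 (direction RE-TABLE FINAL: the road carries `mixFF := mixFFAt ρ_c`,
whose localisation constant is `mixAbs ρ_c L`, lit `biLoc_mixFFAt`): it prices NO word by itself and proves NO (1.22) row; nothing of Bałaban's asserted or valued;
no value of any table asserted; 0 root-level binders of row D1 discharged (hW ∕ hR-sockets ∕ hSX-socket ∕ D1Tel ∕ D1Rep = 0); (J1) ONE OPEN ROW (RE-TABLE's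
viability (B) pending by value); (K) NOT closed; NOT D1, NEVER «G-an2-4 closed», NOT `BetaPertH`, NOT continuum, NOT Clay.

ABSOLUTE RULE (cell charter, verbatim): «No internally-minted statement may enter as a cited fact. Every hypothesis is either kernel-proved in
this package or a verbatim quotation of a PUBLISHED theorem with page reference. The manuscript(s) under audit are NOT citable for their own
disputed steps — they are the thing under adjudication; programme-internal (2001/route/tribunal) claims are never citable.»

WHY ∕ HOW.  Verbatim the «SYMMIX-MASS» argument with node 12b's comb objects in place of an1's symmetrised ones: `mixAbs ρ L = Σ_μ Σ_{(f,f′,g) ∈ bondSet³}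
|a(f,g,f′) + a′(f,g,f′) − a(f′,g,f)|`; by §1 each of the three words is the top row of ONE element `X = MjetAt ℚ ρ W♭ V♭ B♭ L μ 0` (resp. `X′`) of FILE 3's
recording algebra; the comb averaging `PhiGAt` is `expT` of the MEAN over the `L^d` rooted closed loops `loopCAt` (each of `≤ ell d L` letters, lit
`loopCAt_length_le_ell`) times `hol(c)` — ONE loop family and the weight `(L^d)⁻¹` where the symmetrised averaging has the `(d!)²·L^d` pair loops `loopPAt` and the
weight `((d!)²L^d)⁻¹`; the cancellation `weight × #loops = 1` is the same, so the chain of FILE 1's polynomial letters ends in the SAME `ν(X) ≤ Kmix β` (§2), the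
recording algebra at `t := 1∕(25·ell)` gives the SAME top-row mass `≤ 25000·ell³` (§3), and summing the three words and the `d` directions gives `75000·d·ell³`
(§4).  The numeral is honest and crude exactly as in FILE 5; only the LAW `≍ ell³ ≍ n³` is the point.

CONTENT ([folklore] throughout).  §1 `mapDual3_PhiMAt`, **`MjetAt_map`** (naturality of node 12b's mixed jet under `ℚ`-algebra homomorphisms — FILE 4's
`symMjetAt_map` with `symPhiMAt ↦ PhiMAt`), **`aTab_eq_entry ∕ apTab_eq_entry`** (`a(w₁,w₃,w₂) = X_{•,(w₁,w₂,w₃)}`, `a′(w₁,w₂,w₃) = X′_{•,(w₁,w₂,w₃)}`); §2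
`logT_loopC_le ∕ meanC_le`, **`PhiGAt_sub_one_le`** (`ν(Φ^ρ_b − 1) ≤ phiC β`, ANY `ℚ`-algebra with a ring seminorm), **`norm_MjetAt_le`** (`ν(M^ρ_b) ≤ Kmix β`);
§3 **`sum_abs_entry_le`** (top-row mass `≤ 25000·ell³`); §4 **`mixAbs_le`**, **`mixAbs_ctr_le`**, `mixAbs_ctr4_le` (`d = 4`: `≤ 3·10⁸·n³`).
NOT HERE (honest): the (rest) row itself at the comb tables (the road's RETABLE-SPEC ∕ WANTED); the comb first-order ∕ border ∕ `H` tables (gan24-leaf-05's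
`CombHessTableMass` lane); the sharper `mixAbs = 2·Σ|a∘swap|` route (this lineage's staged OFFER O-g30-1 «MIXED-JET-LIE», not in the tree); per-`μ` variants.
Unit `b2b-balaban-beta-d1-formalise-leaf-04` (gen 31), D1 formalisation swarm LEAF PROVER 04, road «BF-x» supplier; INTENT I-leaf04-g31-1 «COMB-MIXED-TABLE-MASS»
(journal).  Not in print; our bookkeeping.  No existing file touched.
-/

noncomputable section

open Finset
open scoped BigOperators Nat
open Literature.MathematicalPhysics.QuantumFieldTheory.Balaban1983to89.Beta
open Literature.MathematicalPhysics.QuantumFieldTheory.Balaban1983to89.Beta.AffineAveraging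
open Literature.MathematicalPhysics.QuantumFieldTheory.Balaban1983to89.Beta.AveragingContours
open Literature.MathematicalPhysics.QuantumFieldTheory.Balaban1983to89.Beta.AveragingContoursRooted
open Literature.MathematicalPhysics.QuantumFieldTheory.Balaban1983to89.Beta.AveragingHessianKernels
open Literature.MathematicalPhysics.QuantumFieldTheory.Balaban1983to89.Beta.AveragingHessianKernelsRooted (loopCAt_length_le_ell)
open Literature.MathematicalPhysics.QuantumFieldTheory.Balaban1983to89.Beta.AveragingThirdJet
open Literature.MathematicalPhysics.QuantumFieldTheory.Balaban1983to89.Beta.AveragingThirdJet.Tau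
open Literature.MathematicalPhysics.QuantumFieldTheory.Balaban1983to89.Beta.AveragingMixedJetTables
open Summit.QuantumFields.BalabanUV.Beta.D1BFx.TruncatedAlgebraNorms
open Summit.QuantumFields.BalabanUV.Beta.D1BFx.WeightedRowSumNorm
open Summit.QuantumFields.BalabanUV.Beta.D1BFx.WordRecordingAlgebra
open Summit.QuantumFields.BalabanUV.Beta.D1BFx.SymMixedJetRecording
open Summit.QuantumFields.BalabanUV.Beta.D1BFx.SymMixedTableMass

namespace Summit.QuantumFields.BalabanUV.Beta.D1BFx.MixedTableMass

/-! ## §1 Naturality of node 12b's mixed jet; the comb tables as entries of ONE recording-algebra element -/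

section Naturality

variable {d : ℕ} {𝔸 𝔸' : Type*} [Ring 𝔸] [Algebra ℚ 𝔸] [Ring 𝔸'] [Algebra ℚ 𝔸'] (ψ : 𝔸 →ₐ[ℚ] 𝔸')

/-- [folklore] NATURALITY of node 12b's rooted mixed averaging under `mapDual³ ψ`. -/
theorem mapDual3_PhiMAt (ρ : Fin d → ℤ) (W V B : Form1 d 𝔸) (L : ℕ) (μ : Fin d) (y : Fin d → ℤ) :
    mapDual (mapDual (mapDual ψ)) (PhiMAt ℚ ρ W V B L μ y)
      = PhiMAt ℚ ρ (fun κ x => ψ (W κ x)) (fun κ x => ψ (V κ x)) (fun κ x => ψ (B κ x)) L μ y := by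
  rw [PhiMAt, PhiMAt, map_PhiGAt]
  simp only [mapDual3_Gm, mapDual3_Gmb]

set_option synthInstance.maxHeartbeats 40000 in
/-- [folklore] **NATURALITY OF NODE 12b's MIXED JET** under `ℚ`-algebra homomorphisms: `ψ (M^ρ_b(W,V;B)) = M^ρ_b(ψW, ψV; ψB)`.
(The `Mul (Rho 𝔸′)` instance search on the `map_logT` line needs between 17 000 and 18 000 of the default 20 000 `synthInstance` heartbeats on the check
farm — the hub build's overhead class; the scoped option above doubles the budget, as in FILE 4 v1.1's `symMjetAt_map`.) -/
theorem MjetAt_map (ρ : Fin d → ℤ) (W V B : Form1 d 𝔸) (L : ℕ) (μ : Fin d) (y : Fin d → ℤ) :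
    ψ (MjetAt ℚ ρ W V B L μ y)
      = MjetAt ℚ ρ (fun κ x => ψ (W κ x)) (fun κ x => ψ (V κ x)) (fun κ x => ψ (B κ x)) L μ y := by
  have h0 : (fun κ x => ψ ((0 : Form1 d 𝔸) κ x)) = (0 : Form1 d 𝔸') := by funext κ x; simp
  have e := congrArg (fun Z : Rho 𝔸' => c11 Z.snd)
    (map_logT (mapDual (mapDual (mapDual ψ))) (PhiMAt ℚ ρ W V B L μ y * invT (PhiMAt ℚ ρ 0 0 B L μ y)))
  simp only [map_mul, map_invT, mapDual3_PhiMAt, h0, snd_mapDual, c11_mapDual2] at e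
  rw [MjetAt, MjetAt]; exact e

end Naturality

section Identification

variable {d : ℕ} (ρ : Fin d → ℤ) (L : ℕ) (μ : Fin d)

/-- [folklore] **`a(u, x, v) = X_{•,(u,v,x)}`** for `X := M^ρ_b(W♭, V♭; B♭)` in the recording algebra. -/
theorem aTab_eq_entry (w : SB d L × SB d L × SB d L) :
    (aTab ρ L μ 0 (w.1 : Bond d) (w.2.2 : Bond d) (w.2.1 : Bond d) : ℚ)
      = ((MjetAt ℚ ρ (recW d L) (rec12 d L) (rec23 d L) L μ 0 : recAlg (SB d L)) : Matrix (Idx (SB d L)) (Idx (SB d L)) ℚ)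
          Idx.nil (Idx.three w.1 w.2.1 w.2.2) := by
  have e := MjetAt_map (theta w) ρ (recW d L) (rec12 d L) (rec23 d L) L μ 0
  rw [theta_recW, theta_rec12, theta_rec23] at e
  have e03 := congrFun (congrFun e 0) 3
  rw [theta_apply] at e03
  rw [aTab, ← e03]; rfl

/-- [folklore] **`a′(u, v, x) = X′_{•,(u,v,x)}`** for `X′ := M^ρ_b(W♭, (2→3)♭; (1→2)♭)`. -/
theorem apTab_eq_entry (w : SB d L × SB d L × SB d L) :
    (apTab ρ L μ 0 (w.1 : Bond d) (w.2.1 : Bond d) (w.2.2 : Bond d) : ℚ)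
      = ((MjetAt ℚ ρ (recW d L) (rec23 d L) (rec12 d L) L μ 0 : recAlg (SB d L)) : Matrix (Idx (SB d L)) (Idx (SB d L)) ℚ)
          Idx.nil (Idx.three w.1 w.2.1 w.2.2) := by
  have e := MjetAt_map (theta w) ρ (recW d L) (rec23 d L) (rec12 d L) L μ 0
  rw [theta_recW, theta_rec12, theta_rec23] at e
  have e03 := congrFun (congrFun e 0) 3
  rw [theta_apply] at e03
  rw [apTab, ← e03]; rfl

end Identification

/-! ## §2 The comb (42)-averaging step in a generic normed `ℚ`-algebra: ONE loop family, weight `(L^d)⁻¹` -/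

section Averaging

variable {d : ℕ} {R : Type*} [Ring R] [Algebra ℚ R] (νR : RingSeminorm R)

/-- [folklore] Comb averaging, step 1: every rooted closed loop's `logT hol` has `ν ≤ plog β` when `ν (U − 1) ≤ m − 1` and `m^ell − 1 ≤ β`. -/
theorem logT_loopC_le (h1 : νR 1 ≤ 1) (hs : ∀ (c : ℚ) (y : R), νR (algebraMap ℚ R c * y) ≤ |(c : ℝ)| * νR y) {m β : ℝ} (hm : 1 ≤ m)
    {G Gb : Form1 d R} (hG : ∀ κ x, νR (G κ x - 1) ≤ m - 1) (hGb : ∀ κ x, νR (Gb κ x - 1) ≤ m - 1)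
    {L : ℕ} (hL : 1 ≤ L) {r : Fin d → ℕ} (hr : r ∈ box d L) (hβ : m ^ ell d L - 1 ≤ β) (μ : Fin d) (y : Fin d → ℤ)
    {b : Fin d → ℕ} (hb : b ∈ box d L) :
    νR (logT ℚ (holG G Gb (loopCAt (toSite r) δ L μ y b))) ≤ plog β := by
  have h1' := holG_sub_one_le νR h1 hm (P := fun _ => True) (fun κ x _ => hG κ x) (fun κ x _ => hGb κ x)
    (lettersIn_loopCAt_top (toSite r) δ L μ y b)
  have hlen := loopCAt_length_le_ell (δ : Form1 d (LetterGrp d)) hL μ y hr hb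
  exact logT_le νR hs (h1'.trans ((sub_le_sub_right (pow_le_pow_right₀ hm hlen) 1).trans hβ))

/-- [folklore] Comb averaging, step 2: the MEAN of the loop logarithms has `ν ≤ plog β` (exact `(L^d)⁻¹ × #` cancellation). -/
theorem meanC_le (h1 : νR 1 ≤ 1) (hs : ∀ (c : ℚ) (y : R), νR (algebraMap ℚ R c * y) ≤ |(c : ℝ)| * νR y) {m β : ℝ} (hm : 1 ≤ m)
    {G Gb : Form1 d R} (hG : ∀ κ x, νR (G κ x - 1) ≤ m - 1) (hGb : ∀ κ x, νR (Gb κ x - 1) ≤ m - 1)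
    {L : ℕ} (hL : 1 ≤ L) {r : Fin d → ℕ} (hr : r ∈ box d L) (hβ : m ^ ell d L - 1 ≤ β) (μ : Fin d) (y : Fin d → ℤ) :
    νR (((L : ℚ) ^ d)⁻¹ • ∑ b ∈ box d L, logT ℚ (holG G Gb (loopCAt (toSite r) δ L μ y b))) ≤ plog β := by
  have hbox : (box d L).card = L ^ d := by
    simp only [AffineAveraging.box, Fintype.card_piFinset, Finset.card_range, Finset.prod_const, Finset.card_univ, Fintype.card_fin]
  have hsum : νR (∑ b ∈ box d L, logT ℚ (holG G Gb (loopCAt (toSite r) δ L μ y b))) ≤ (L ^ d : ℕ) * plog β := by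
    rw [← hbox]
    exact sum_le_card_mul νR _ _ fun b hb => logT_loopC_le νR h1 hs hm hG hGb hL hr hβ μ y hb
  have hL0 : (L : ℝ) ≠ 0 := by exact_mod_cast (show L ≠ 0 by omega)
  rw [Algebra.smul_def]
  refine (hs _ _).trans ?_
  have habs : |((((L : ℚ) ^ d)⁻¹ : ℚ) : ℝ)| = ((L : ℝ) ^ d)⁻¹ := by
    push_cast
    rw [abs_inv, abs_of_nonneg (by positivity)]
  rw [habs]
  calc ((L : ℝ) ^ d)⁻¹ * νR (∑ b ∈ box d L, logT ℚ (holG G Gb (loopCAt (toSite r) δ L μ y b)))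
      ≤ ((L : ℝ) ^ d)⁻¹ * ((L ^ d : ℕ) * plog β) := mul_le_mul_of_nonneg_left hsum (by positivity)
    _ = plog β := by push_cast; field_simp

/-- [folklore] **THE COMB (42)-AVERAGING STEP**: if both transporter families have `ν (U − 1) ≤ m − 1` (`1 ≤ m`) and `m^ell − 1 ≤ β`, then
`ν (Φ^ρ_b − 1) ≤ φ(β)` for every root offset in the box (`1 ≤ L`) — any `ℚ`-algebra with a ring seminorm, `ν 1 ≤ 1`, `ν(c·x) ≤ |c|·ν x`. -/
theorem PhiGAt_sub_one_le (h1 : νR 1 ≤ 1) (hs : ∀ (c : ℚ) (y : R), νR (algebraMap ℚ R c * y) ≤ |(c : ℝ)| * νR y) {m β : ℝ}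
    (hm : 1 ≤ m) {G Gb : Form1 d R} (hG : ∀ κ x, νR (G κ x - 1) ≤ m - 1) (hGb : ∀ κ x, νR (Gb κ x - 1) ≤ m - 1)
    {L : ℕ} (hL : 1 ≤ L) {r : Fin d → ℕ} (hr : r ∈ box d L) (hβ : m ^ ell d L - 1 ≤ β) (μ : Fin d) (y : Fin d → ℤ) :
    νR (PhiGAt ℚ (toSite r) G Gb L μ y - 1) ≤ phiC β := by
  have hexp := expT_sub_one_le νR hs (meanC_le νR h1 hs hm hG hGb hL hr hβ μ y)
  have hseg := seg_sub_one_le νR h1 hm hG hGb hβ (toSite r) μ y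
  rw [PhiGAt]
  refine (mul_sub_one_le νR hexp hseg).trans (le_of_eq ?_)
  unfold phiC pexp; ring

end Averaging

section Jet

variable {d : ℕ} {𝔸 : Type*} [Ring 𝔸] [Algebra ℚ 𝔸] (ν : RingSeminorm 𝔸)

/-- [folklore] **NODE 12b's MIXED JET IN NORM**: `ν (M^ρ_b(W,V;B)) ≤ K(β)` under the chart-letter bounds (both charts) and `m^ell − 1 ≤ β`. -/
theorem norm_MjetAt_le (h1 : ν 1 ≤ 1) (hs : ∀ (c : ℚ) (y : 𝔸), ν (algebraMap ℚ 𝔸 c * y) ≤ |(c : ℝ)| * ν y) {m β : ℝ} (hm : 1 ≤ m) {W V B : Form1 d 𝔸}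
    (hU : ∀ κ x, rhoRS ν (Gm ℚ W V B κ x - 1) ≤ m - 1) (hUb : ∀ κ x, rhoRS ν (Gmb ℚ W V B κ x - 1) ≤ m - 1)
    (hE : ∀ κ x, rhoRS ν (Gm ℚ 0 0 B κ x - 1) ≤ m - 1) (hEb : ∀ κ x, rhoRS ν (Gmb ℚ 0 0 B κ x - 1) ≤ m - 1)
    {L : ℕ} (hL : 1 ≤ L) {r : Fin d → ℕ} (hr : r ∈ box d L) (hβ : m ^ ell d L - 1 ≤ β) (μ : Fin d) (y : Fin d → ℤ) :
    ν (MjetAt ℚ (toSite r) W V B L μ y) ≤ Kmix β := by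
  have hΦU : rhoRS ν (PhiMAt ℚ (toSite r) W V B L μ y - 1) ≤ phiC β :=
    PhiGAt_sub_one_le (rhoRS ν) (rhoRS_one_le ν h1) (rhoRS_smul_le ν hs) hm hU hUb hL hr hβ μ y
  have hΦE : rhoRS ν (PhiMAt ℚ (toSite r) 0 0 B L μ y - 1) ≤ phiC β :=
    PhiGAt_sub_one_le (rhoRS ν) (rhoRS_one_le ν h1) (rhoRS_smul_le ν hs) hm hE hEb hL hr hβ μ y
  have hinv : rhoRS ν (invT (PhiMAt ℚ (toSite r) 0 0 B L μ y) - 1) ≤ psiC β := invT_sub_one_le (rhoRS ν) hΦE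
  have hprod := mul_sub_one_le (rhoRS ν) hΦU hinv
  have hlog := logT_le (rhoRS ν) (rhoRS_smul_le ν hs) hprod
  rw [MjetAt]
  exact (c11_snd_le_rhoRS ν _).trans hlog

end Jet

/-! ## §3 The recording algebra at `t = 1∕(25·ell)`: the top-row masses of `X` and `X′` are `≤ 25000·ell³` -/

section Mass

variable {d L : ℕ}

/-- [folklore] **TOP-ROW MASS of a recording-algebra comb mixed jet**: for any choice of the three recording forms as `(W, V, B)` with norms `≤ t`,
`Σ_{w ∈ S³} |X_{•,(w)}| ≤ 25000·ell³`. -/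
theorem sum_abs_entry_le (hL : 1 ≤ L) {r : Fin d → ℕ} (hr : r ∈ box d L) (μ : Fin d) {W V B : Form1 d (recAlg (SB d L))}
    (hW : ∀ {t : ℝ}, 0 < t → ∀ κ x, mnorm (lvW t) (W κ x : Matrix (Idx (SB d L)) (Idx (SB d L)) ℚ) ≤ t)
    (hV : ∀ {t : ℝ}, 0 < t → ∀ κ x, mnorm (lvW t) (V κ x : Matrix (Idx (SB d L)) (Idx (SB d L)) ℚ) ≤ t)
    (hB : ∀ {t : ℝ}, 0 < t → ∀ κ x, mnorm (lvW t) (B κ x : Matrix (Idx (SB d L)) (Idx (SB d L)) ℚ) ≤ t) :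
    ∑ w : SB d L × SB d L × SB d L,
        |(((MjetAt ℚ (toSite r) W V B L μ 0 : recAlg (SB d L)) : Matrix (Idx (SB d L)) (Idx (SB d L)) ℚ)
          Idx.nil (Idx.three w.1 w.2.1 w.2.2) : ℝ)| ≤ 25000 * (ell d L : ℝ) ^ 3 := by
  have hell : (1 : ℝ) ≤ ell d L := by unfold ell; exact_mod_cast (show 1 ≤ (2 * d + 2) * L by nlinarith)
  obtain ⟨t, ht_def⟩ : ∃ t : ℝ, t = 1 / (25 * ell d L) := ⟨_, rfl⟩
  have ht : 0 < t := by rw [ht_def]; positivity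
  obtain ⟨ν, hν_def⟩ : ∃ ν : RingSeminorm (recAlg (SB d L)), ν = restrictRS (mnormRS (lvW_pos ht)) (recAlg (SB d L)) := ⟨_, rfl⟩
  have hν : ∀ x : recAlg (SB d L), ν x = mnorm (lvW t) (x : Matrix (Idx (SB d L)) (Idx (SB d L)) ℚ) := fun x => by
    rw [hν_def, restrictRS_apply, mnormRS_apply]
  have h1 : ν 1 ≤ 1 := by rw [hν, OneMemClass.coe_one]; exact mnorm_one_le (lvW_pos ht)
  have hs : ∀ (c : ℚ) (y : recAlg (SB d L)), ν (algebraMap ℚ (recAlg (SB d L)) c * y) ≤ |(c : ℝ)| * ν y := fun c y => by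
    rw [hν, hν, MulMemClass.coe_mul, Subalgebra.coe_algebraMap]; exact mnorm_smul_le (lvW_pos ht) c _
  have hWν : ∀ κ x, ν (W κ x) ≤ t := fun κ x => by rw [hν]; exact hW ht κ x
  have hVν : ∀ κ x, ν (V κ x) ≤ t := fun κ x => by rw [hν]; exact hV ht κ x
  have hBν : ∀ κ x, ν (B κ x) ≤ t := fun κ x => by rw [hν]; exact hB ht κ x
  have h0 : ∀ κ x, ν ((0 : Form1 d (recAlg (SB d L))) κ x) ≤ t := fun κ x => by
    rw [Pi.zero_apply, Pi.zero_apply, map_zero]; exact ht.le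
  have hm : (1 : ℝ) ≤ (1 + t) ^ 3 := one_le_pow₀ (by linarith)
  have hU := rhoRS_Gm_sub_one_le ν h1 hs ht.le hWν hVν hBν
  have hUb := rhoRS_Gmb_sub_one_le ν h1 hs ht.le hWν hVν hBν
  have hE := rhoRS_Gm_sub_one_le ν h1 hs ht.le h0 h0 hBν
  have hEb := rhoRS_Gmb_sub_one_le ν h1 hs ht.le h0 h0 hBν
  -- m^ell − 1 ≤ 3/22 at t = 1/(25 ell)
  have hβ : ((1 + t) ^ 3) ^ ell d L - 1 ≤ 3 / 22 := by
    have h1 : ((1 + t) ^ 3) ^ ell d L = (1 + t) ^ (3 * ell d L) := by rw [pow_mul]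
    have h2 : ((3 * ell d L : ℕ) : ℝ) * t = 3 / 25 := by rw [ht_def]; push_cast; field_simp
    have h3 := one_add_pow_le ht.le (n := 3 * ell d L) (by rw [h2]; norm_num)
    rw [h2] at h3
    rw [h1]; linarith [show (1 : ℝ) / (1 - 3 / 25) = 25 / 22 by norm_num]
  have hX : ν (MjetAt ℚ (toSite r) W V B L μ 0) ≤ 8 / 5 :=
    (norm_MjetAt_le ν h1 hs hm hU hUb hE hEb hL hr hβ μ 0).trans Kmix_num
  rw [hν] at hX
  have hrow := sum_three_le ht ((MjetAt ℚ (toSite r) W V B L μ 0 : recAlg (SB d L)) : Matrix (Idx (SB d L)) (Idx (SB d L)) ℚ)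
  have key := hrow.trans hX
  have ht3 : t ^ 3 * (15625 * (ell d L : ℝ) ^ 3) = 1 := by rw [ht_def]; field_simp; norm_num
  have hpos : 0 < 15625 * (ell d L : ℝ) ^ 3 := by positivity
  have hS : 0 ≤ ∑ w : SB d L × SB d L × SB d L,
      |(((MjetAt ℚ (toSite r) W V B L μ 0 : recAlg (SB d L)) : Matrix (Idx (SB d L)) (Idx (SB d L)) ℚ)
        Idx.nil (Idx.three w.1 w.2.1 w.2.2) : ℝ)| := Finset.sum_nonneg fun _ _ => abs_nonneg _
  nlinarith

end Mass

/-! ## §4 THE LETTER: `mixAbs (toSite r) L ≤ 75000 · d · ell³` -/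

section Main

variable {d L : ℕ}

/-- [folklore] **THE n-LAW OF NODE 12b's `mixAbs` (the reference-block `ℓ¹` mass of the comb mixed table `t`)**: for every root offset in the box and
`1 ≤ L`, `mixAbs (toSite r) L ≤ 75000 · d · (ell d L)³` (`ell d L = (2d+2)·L`). No hypothesis on any table; no value asserted. -/
theorem mixAbs_le (hL : 1 ≤ L) {r : Fin d → ℕ} (hr : r ∈ box d L) :
    mixAbs (toSite r) L ≤ 75000 * d * (ell d L : ℝ) ^ 3 := by
  have hA : ∀ μ : Fin d, ∑ w : SB d L × SB d L × SB d L,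
      |(((MjetAt ℚ (toSite r) (recW d L) (rec12 d L) (rec23 d L) L μ 0 : recAlg (SB d L)) :
        Matrix (Idx (SB d L)) (Idx (SB d L)) ℚ) Idx.nil (Idx.three w.1 w.2.1 w.2.2) : ℝ)| ≤ 25000 * (ell d L : ℝ) ^ 3 :=
    fun μ => sum_abs_entry_le hL hr μ (fun ht => mnorm_recW_le ht) (fun ht => mnorm_rec12_le ht) (fun ht => mnorm_rec23_le ht)
  have hA' : ∀ μ : Fin d, ∑ w : SB d L × SB d L × SB d L,
      |(((MjetAt ℚ (toSite r) (recW d L) (rec23 d L) (rec12 d L) L μ 0 : recAlg (SB d L)) :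
        Matrix (Idx (SB d L)) (Idx (SB d L)) ℚ) Idx.nil (Idx.three w.1 w.2.1 w.2.2) : ℝ)| ≤ 25000 * (ell d L : ℝ) ^ 3 :=
    fun μ => sum_abs_entry_le hL hr μ (fun ht => mnorm_recW_le ht) (fun ht => mnorm_rec23_le ht) (fun ht => mnorm_rec12_le ht)
  -- the permutations of the alphabet cube used to re-index the second and third words of `t`
  let e₁ : SB d L × SB d L × SB d L ≃ SB d L × SB d L × SB d L :=
    { toFun := fun w => (w.1, w.2.2, w.2.1), invFun := fun w => (w.1, w.2.2, w.2.1), left_inv := fun _ => rfl, right_inv := fun _ => rfl }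
  let e₂ : SB d L × SB d L × SB d L ≃ SB d L × SB d L × SB d L :=
    { toFun := fun w => (w.2.1, w.1, w.2.2), invFun := fun w => (w.2.1, w.1, w.2.2), left_inv := fun _ => rfl, right_inv := fun _ => rfl }
  have hμ : ∀ μ : Fin d, ∑ p ∈ (bondSet d L ×ˢ bondSet d L) ×ˢ bondSet d L,
      |(tTab (toSite r) L μ 0 p.1.1 p.1.2 p.2 : ℝ)| ≤ 75000 * (ell d L : ℝ) ^ 3 := by
    intro μ
    rw [sum_bondSet_cube_eq (fun f f' g => |(tTab (toSite r) L μ 0 f f' g : ℝ)|)]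
    set X := ((MjetAt ℚ (toSite r) (recW d L) (rec12 d L) (rec23 d L) L μ 0 : recAlg (SB d L)) :
        Matrix (Idx (SB d L)) (Idx (SB d L)) ℚ) with hX
    set X' := ((MjetAt ℚ (toSite r) (recW d L) (rec23 d L) (rec12 d L) L μ 0 : recAlg (SB d L)) :
        Matrix (Idx (SB d L)) (Idx (SB d L)) ℚ) with hX'
    have hpt : ∀ w : SB d L × SB d L × SB d L, |(tTab (toSite r) L μ 0 (w.1 : Bond d) (w.2.1 : Bond d) (w.2.2 : Bond d) : ℝ)|
        ≤ |(X Idx.nil (Idx.three w.1 w.2.1 w.2.2) : ℝ)| + |(X' Idx.nil (Idx.three w.1 w.2.2 w.2.1) : ℝ)|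
          + |(X Idx.nil (Idx.three w.2.1 w.1 w.2.2) : ℝ)| := by
      intro w
      have h1 := aTab_eq_entry (toSite r) L μ w
      have h2 := apTab_eq_entry (toSite r) L μ (w.1, w.2.2, w.2.1)
      have h3 := aTab_eq_entry (toSite r) L μ (w.2.1, w.1, w.2.2)
      dsimp only at h2 h3
      rw [← hX] at h1 h3
      rw [← hX'] at h2
      rw [tTab, Rat.cast_sub, Rat.cast_add, h1, h2, h3]
      have := abs_add_le ((X Idx.nil (Idx.three w.1 w.2.1 w.2.2) : ℚ) : ℝ) ((X' Idx.nil (Idx.three w.1 w.2.2 w.2.1) : ℚ) : ℝ)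
      have := abs_sub (((X Idx.nil (Idx.three w.1 w.2.1 w.2.2) : ℚ) : ℝ) + ((X' Idx.nil (Idx.three w.1 w.2.2 w.2.1) : ℚ) : ℝ))
        ((X Idx.nil (Idx.three w.2.1 w.1 w.2.2) : ℚ) : ℝ)
      linarith
    have hs1 : ∑ w : SB d L × SB d L × SB d L, |(X' Idx.nil (Idx.three w.1 w.2.2 w.2.1) : ℝ)|
        = ∑ w : SB d L × SB d L × SB d L, |(X' Idx.nil (Idx.three w.1 w.2.1 w.2.2) : ℝ)| :=
      Fintype.sum_equiv e₁ _ _ fun _ => rfl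
    have hs2 : ∑ w : SB d L × SB d L × SB d L, |(X Idx.nil (Idx.three w.2.1 w.1 w.2.2) : ℝ)|
        = ∑ w : SB d L × SB d L × SB d L, |(X Idx.nil (Idx.three w.1 w.2.1 w.2.2) : ℝ)| :=
      Fintype.sum_equiv e₂ _ _ fun _ => rfl
    refine (Finset.sum_le_sum fun w _ => hpt w).trans ?_
    rw [Finset.sum_add_distrib, Finset.sum_add_distrib, hs1, hs2]
    linarith [hA μ, hA' μ]
  unfold mixAbs
  calc ∑ μ : Fin d, ∑ p ∈ (bondSet d L ×ˢ bondSet d L) ×ˢ bondSet d L, |(tTab (toSite r) L μ 0 p.1.1 p.1.2 p.2 : ℝ)|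
      ≤ ∑ _μ : Fin d, 75000 * (ell d L : ℝ) ^ 3 := Finset.sum_le_sum fun μ _ => hμ μ
    _ = 75000 * d * (ell d L : ℝ) ^ 3 := by
        rw [Finset.sum_const, Finset.card_univ, Fintype.card_fin, nsmul_eq_mul]; ring

/-- [folklore] **AT THE CENTRED ROOT**: `mixAbs (ctr d n) n ≤ 75000 · d · ((2d+2)·n)³` for `1 ≤ n` (at the road's `d = 4`: `≤ 3·10⁸ · n³`). -/
theorem mixAbs_ctr_le {n : ℕ} (hn : 1 ≤ n) :
    mixAbs (ctr d n) n ≤ 75000 * d * (((2 * d + 2) * n : ℕ) : ℝ) ^ 3 := by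
  have h := mixAbs_le hn (ctrOff_mem_box (d := d) hn)
  exact h

/-- [folklore] **AT THE ROAD's `d = 4`, the numeral multiplied out**: `mixAbs (ctr 4 n) n ≤ 3·10⁸ · n³` (`1 ≤ n` via `[NeZero n]` — the (rest)-row consumer's
socket shape, cf. gan24-leaf-05's `symMixAbs_ctr4_le`). -/
theorem mixAbs_ctr4_le (n : ℕ) [NeZero n] : mixAbs (ctr 4 n) n ≤ 300000000 * (n : ℝ) ^ 3 := by
  have h := mixAbs_ctr_le (d := 4) (Nat.one_le_iff_ne_zero.2 (NeZero.ne n))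
  calc mixAbs (ctr 4 n) n ≤ 75000 * (4 : ℕ) * (((2 * 4 + 2) * n : ℕ) : ℝ) ^ 3 := h
    _ = 300000000 * (n : ℝ) ^ 3 := by push_cast; ring

end Main

end Summit.QuantumFields.BalabanUV.Beta.D1BFx.MixedTableMass

end
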